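import Summits.KontsevichZagierPeriods.KontsevichZagierPeriods.Theorems.RootDecompRelativeModAbsoluteCylLogSplitP32

/-! # `RootDecompRelativeModAbsoluteCylLogSplitP33` — part 8/27 of the mechanical ≤400-line split of `RungClosure.lean` (sha256 f909f334226f0fb5…)
Source: decomp-kz lens-3 g12 `RungClosure.lean` v9 (HOME/decomp-kz-lens-3/g12/, sha256 f909f334…; critic g4-52/g4-57/g5 CLEARED, «lander: split v9 --supports 30572»): BLOCK I (57 g11 monolith decls missing from P01–P25), BLOCK II/III (WildCertAssembly parts 1–6, 8–10: `Leaf.cellLocalWildCert`, `Leaf.cylKernelZeroLog_of_trees`), Parts 12–13 (`Leaf.regKernelPairDegOne_iff_circlePos_of_trees`), BLOCK G13 (Möbius engine, test §C decided).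
Split by census-1 g9 `gen/splitlean.py`: scopes re-opened with their `open`/`variable`/`set_option` context; mathematics and declaration order unchanged. -/

noncomputable section
open Set MeasureTheory Filter Topology
open scoped BigOperators
open Literature.NumberTheory.Transcendental Literature.ModelTheory.ExponentialFields
namespace Summit.KontsevichZagierPeriods.RootDecompRelativeModAbsolute.Rung30571
namespace RegularisedLogLayer
namespace CylLog
variable {b : ℕ}
namespace TestB
open DegenerateInstance MixedInstance

/-- Auxiliary step `c_zero`: c zero. [bookkeeping] -/
@[simp] theorem c_zero : c 0 = fun _ => -1 := rfl
/-- Auxiliary step `c_one`: c one. [bookkeeping] -/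
@[simp] theorem c_one : c 1 = fun x => -1 / (1 + x 0) ^ 2 := rfl
/-- Auxiliary step `κ_zero`: κ zero. [bookkeeping] -/
@[simp] theorem κ_zero : κ 0 = κP := rfl
/-- Auxiliary step `κ_one`: κ one. [bookkeeping] -/
@[simp] theorem κ_one : κ 1 = κN := rfl
/-- Auxiliary step `σ_zero`: σ zero. [bookkeeping] -/
@[simp] theorem σ_zero : σ 0 = 0 := rfl
/-- Auxiliary step `σ_one`: σ one. [bookkeeping] -/
@[simp] theorem σ_one : σ 1 = 1 := rfl
/-- Auxiliary step `M_apply`: M apply. [bookkeeping] -/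
@[simp] theorem M_apply (i : Fin 2) : M i = 1 := rfl

/-- **Test §B is certified**: `Z = {1,2}`, `m = 1`, one relation `g = (1,1)`, `qq = x⁻²`, `Ñ = 0`. -/
theorem wildCellCert : WildCellCert G c κ M σ := by
  have hG := isSemialgebraic_G
  have hGm : MeasurableSet G := hG.measurableSet_holds
  have hfin := volume_G_lt_top
  have h0sa : IsSemialgebraicFunOn ℚ G (fun _ => (0:ℝ)) :=
    (isSemialgebraicFunOn_ratCast hG 0).congr fun _ _ => by simp
  have h1sa : IsSemialgebraicFunOn ℚ G (fun _ => (1:ℝ)) :=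
    (isSemialgebraicFunOn_ratCast hG 1).congr fun _ _ => by simp
  -- bounded semialgebraic closed forms used below
  have hI : ∀ (F : (Fin 1 → ℝ) → ℝ) (C : ℝ), IsSemialgebraicFunOn ℚ G F → (∀ x ∈ G, |F x| ≤ C) →
      IntegrableOn F G := fun F C hF hC => integrableOn_of_abs_le hG hfin hF C hC
  have hx : ∀ x ∈ G, 0 < x 0 ∧ x 0 < 1 := fun x hx => hx
  have hinv1 : IntegrableOn (fun x : Fin 1 → ℝ => 1 / (1 + x 0)) G := by
    refine hI _ 1 (IsSemialgebraicFunOn.div h1sa sa_one_add one_add_ne) fun x hx => ?_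
    have h := (hx).1
    rw [abs_of_pos (by positivity), div_le_one (by linarith)]
    linarith
  have hinv2 : IntegrableOn (fun x : Fin 1 → ℝ => 1 / (1 + x 0) ^ 2) G := by
    refine hI _ 1 (IsSemialgebraicFunOn.div h1sa (isSemialgebraicFunOn_pow' hG sa_one_add 2)
      fun x hx => pow_ne_zero _ (one_add_ne x hx)) fun x hx => ?_
    have h := (hx).1
    rw [abs_of_pos (by positivity), div_le_one (by positivity)]
    nlinarith
  have hconst : ∀ C : ℝ, IntegrableOn (fun _ : Fin 1 → ℝ => C) G := fun C => by
    haveI : IsFiniteMeasure (volume.restrict G) := ⟨by rwa [Measure.restrict_apply_univ]⟩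
    exact integrable_const C
  have hqsa : IsSemialgebraicFunOn ℚ G (fun x : Fin 1 → ℝ => 1 / x 0 ^ 2) :=
    IsSemialgebraicFunOn.div h1sa (isSemialgebraicFunOn_pow' hG sa_x 2) fun x hx => pow_ne_zero _ hx.1.ne'
  -- normal forms on `G`
  have nf : ∀ x ∈ G, x 0 ≠ 0 ∧ (1:ℝ) + x 0 ≠ 0 ∧ 1 + κN x = 1 / (1 + x 0) ∧ κN x = -x 0 / (1 + x 0) ∧
      κP x = x 0 := fun x hx => ⟨hx.1.ne', one_add_ne x hx, one_add_κN x hx, rfl, rfl⟩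
  have hσB : (fun i => decide (σ i ≠ 1)) = ![true, false] := by
    funext i; fin_cases i <;> rfl
  refine ⟨fun _ => true, 1, 1, fun _ _ => 1, fun _ x => 1 / x 0 ^ 2, fun _ _ => 0, fun _ _ => le_rfl,
    fun r i h => by simp at h, ?_, fun _ => hqsa, fun _ => h0sa, ?_, fun x _ => by simp, ?_, ?_, ?_, ?_, ?_,
    ?_, ?_, ?_, ?_, ?_, ?_, ?_, ?_⟩
  · -- hrel
    intro r x hx
    obtain ⟨h0, h1, -, -, -⟩ := nf x hx
    simp only [Fin.prod_univ_two, zpow_one, κ_zero, κ_one, κP, κN]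
    field_simp
    ring
  · -- hcoef
    intro i x hx
    obtain ⟨h0, h1, -, -, -⟩ := nf x hx
    fin_cases i
    · show (-1:ℝ) ^ 1 * ((-1) / (x 0) ^ (1 + 1)) = ∑ r : Fin 1, 1 / x 0 ^ 2 * ((1:ℤ):ℝ) + 0
      rw [Fin.sum_univ_one, Int.cast_one, mul_one, add_zero]
      field_simp
    · show (-1:ℝ) ^ 1 * ((-1 / (1 + x 0) ^ 2) / (-x 0 / (1 + x 0)) ^ (1 + 1)) =
        ∑ r : Fin 1, 1 / x 0 ^ 2 * ((1:ℤ):ℝ) + 0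
      rw [Fin.sum_univ_one, Int.cast_one, mul_one, add_zero,
        show (-x 0 / (1 + x 0)) ^ (1 + 1) = x 0 ^ 2 / (1 + x 0) ^ 2 by rw [show (1:ℕ) + 1 = 2 from rfl, div_pow, neg_sq]]
      field_simp
  · -- hZpow
    intro i _ j h1 h2
    obtain rfl : j = 1 := le_antisymm h2 h1
    fin_cases i
    · refine IntegrableOn.congr_fun (hconst (-1)) (fun x hx => ?_) hGm
      obtain ⟨h0, -, -, -, -⟩ := nf x hx
      simp only [Fin.zero_eta, c_zero, κ_zero, κP, M_apply, Nat.reduceAdd]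
      field_simp
    · refine IntegrableOn.congr_fun (hinv2.neg) (fun x hx => ?_) hGm
      obtain ⟨h0, h1, -, -, -⟩ := nf x hx
      simp only [Fin.mk_one, c_one, κ_one, κN, M_apply, Nat.reduceAdd, Pi.neg_apply]
      field_simp
  · -- hZpow'
    intro i _ hs j h1 h2
    obtain rfl : j = 1 := le_antisymm h2 h1
    fin_cases i
    · simp at hs
    · refine IntegrableOn.congr_fun (hinv1.neg) (fun x hx => ?_) hGm
      obtain ⟨h0, h1, -, -, -⟩ := nf x hx
      simp only [Fin.mk_one, c_one, κ_one, κN, M_apply, Nat.reduceAdd, Pi.neg_apply]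
      field_simp
      ring
  · -- hqpow
    intro r i _
    fin_cases i
    · refine IntegrableOn.congr_fun (hconst 1) (fun x hx => ?_) hGm
      obtain ⟨h0, -, -, -, -⟩ := nf x hx
      simp only [Fin.zero_eta, κ_zero, κP, Nat.reduceAdd]
      field_simp
    · refine IntegrableOn.congr_fun hinv2 (fun x hx => ?_) hGm
      obtain ⟨h0, h1, -, -, -⟩ := nf x hx
      simp only [Fin.mk_one, κ_one, κN, Nat.reduceAdd]
      field_simp
  · -- hqpow'
    intro r i _ hs
    fin_cases i
    · simp at hs
    · refine IntegrableOn.congr_fun hinv1 (fun x hx => ?_) hGm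
      obtain ⟨h0, h1, -, -, -⟩ := nf x hx
      simp only [Fin.mk_one, κ_one, κN, Nat.reduceAdd]
      field_simp
      ring
  · -- hNpow
    intro i _
    simp only [zero_mul]
    exact integrableOn_zero
  · -- hNpow'
    intro i _ _
    simp only [zero_mul, zero_div]
    exact integrableOn_zero
  · -- hL
    intro r
    left
    intro x hx
    obtain ⟨h0, h1, -, -, -⟩ := nf x hx
    apply le_of_eq
    simp only [Fin.prod_univ_two, zW, if_true, κ_zero, κ_one, κP, κN, Int.toNat_one, pow_one]
    field_simp
    ring
  · -- hintU
    intro r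
    refine IntegrableOn.congr_fun (hconst 1) (fun x hx => ?_) hGm
    obtain ⟨h0, h1, -, -, -⟩ := nf x hx
    rw [hσB]
    simp only [Fin.prod_univ_two, zW, if_true, multUp, κ_zero, κ_one, κP, κN, Matrix.cons_val_zero,
      Matrix.cons_val_one, Int.toNat_one, pow_one, pow_zero, mul_one, if_false,
      Bool.false_eq_true, Nat.reduceAdd]
    field_simp
    ring
  · -- hintU'
    intro r
    refine IntegrableOn.congr_fun hinv1 (fun x hx => ?_) hGm
    obtain ⟨h0, h1, -, -, -⟩ := nf x hx
    rw [hσB]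
    simp only [Fin.prod_univ_two, zW, if_true, multUp', κ_zero, κ_one, κP, κN, Matrix.cons_val_zero,
      Matrix.cons_val_one, Int.toNat_one, pow_one, pow_zero, one_mul, if_false,
      Bool.true_eq_false, Nat.reduceAdd]
    field_simp
    ring
  · -- hintV
    intro r
    refine IntegrableOn.congr_fun (hconst 0) (fun x hx => ?_) hGm
    rw [hσB]
    simp [zW, multDn]
  · -- hintV'
    intro r
    refine IntegrableOn.congr_fun (hconst 0) (fun x hx => ?_) hGm
    rw [hσB]
    simp [zW, multDn']
  · -- hNlog
    intro i
    simp only [zero_mul]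
    exact integrableOn_zero
  · -- hNtame
    intro i _ j _
    simp only [zero_mul]
    exact integrableOn_zero

/-- Hence test §B carries a (one-piece) LOCALISED wild certificate. -/
theorem localWildCert : LocalWildCert G c κ M σ := by
  refine ⟨1, fun _ => G, fun _ => isOpen_G, fun _ => isSemialgebraic_G, fun _ => Subset.rfl, ?_, ?_,
    fun _ => Or.inr wildCellCert⟩
  · intro i j hij
    exact absurd (Subsingleton.elim i j) hij
  · have h : G \ ⋃ _s : Fin 1, G = ∅ := by
      rw [Set.iUnion_const, sdiff_self]
    rw [h, measure_empty]

end TestB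

/-! ### §3al `LocalWildCert` is LOCAL (g11): certificates on the pieces of ANY finite a.e.-partition assemble
The g12 plan (addendum 2 §E) produces certificates piece by piece after a localisation (F1); this section proves once
and for all that this composes: `exists_flatten_partition` flattens a two-level finite partition up to null sets
(pure measure theory, any measure space), `localWildCert_of_wildCellCert` is the one-piece certificate of a wild cell
(companion of `localWildCert_of_tameCell`), and `localWildCert_of_pieces` assembles `LocalWildCert E …` from
`LocalWildCert (C s) …` on the pieces `C s` of a finite (`Fintype`-indexed) disjoint family covering `E` up to a null set (the coarse pieces
need not be open or semialgebraic — only the certified sub-pieces are).  Hence the residual `CellLocalWildCert` may be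
attacked ONE LOCALISED PIECE AT A TIME. -/

/-- Flattening a two-level finite partition (up to null sets) of `E` into a one-level one, keeping a per-piece
property `R`. -/
theorem exists_flatten_partition {X : Type*} [MeasurableSpace X] (μ : Measure X) {E : Set X} {R : Set X → Prop}
    {ι : Type*} [Fintype ι] {C : ι → Set X} (hCE : ∀ s, C s ⊆ E) (hdisj : Pairwise (Function.onFun Disjoint C))
    (hnull : μ (E \ ⋃ s, C s) = 0)
    (hloc : ∀ s, ∃ (N' : ℕ) (C' : Fin N' → Set X), (∀ t, C' t ⊆ C s) ∧ Pairwise (Function.onFun Disjoint C') ∧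
      μ (C s \ ⋃ t, C' t) = 0 ∧ ∀ t, R (C' t)) :
    ∃ (N'' : ℕ) (C'' : Fin N'' → Set X), (∀ u, C'' u ⊆ E) ∧ Pairwise (Function.onFun Disjoint C'') ∧
      μ (E \ ⋃ u, C'' u) = 0 ∧ ∀ u, R (C'' u) := by
  choose N' C' hsub hdisj' hnull' hR using hloc
  obtain ⟨e⟩ : Nonempty ((Σ s : ι, Fin (N' s)) ≃ Fin (Fintype.card (Σ s : ι, Fin (N' s)))) :=
    ⟨Fintype.equivFin _⟩
  refine ⟨Fintype.card (Σ s : ι, Fin (N' s)), fun u => C' (e.symm u).1 (e.symm u).2,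
    fun u => (hsub _ _).trans (hCE _), ?_, ?_, fun u => hR _ _⟩
  · intro u v huv
    have hab : e.symm u ≠ e.symm v := fun h => huv (e.symm.injective h)
    show Disjoint (C' (e.symm u).1 (e.symm u).2) (C' (e.symm v).1 (e.symm v).2)
    generalize e.symm u = a at hab ⊢
    generalize e.symm v = b at hab ⊢
    obtain ⟨s, t⟩ := a
    obtain ⟨s', t'⟩ := b
    by_cases hs : s = s'
    · subst hs
      have htt : t ≠ t' := fun h => hab (by rw [h])
      exact hdisj' s htt
    · exact Disjoint.mono (hsub s t) (hsub s' t') (hdisj hs)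
  · have hcov : E \ ⋃ u, C' (e.symm u).1 (e.symm u).2 ⊆ (E \ ⋃ s, C s) ∪ ⋃ s, (C s \ ⋃ t, C' s t) := by
      intro x hx
      rw [Set.mem_sdiff, Set.mem_iUnion] at hx
      obtain ⟨hxE, hxn⟩ := hx
      by_cases h : ∃ s, x ∈ C s
      · obtain ⟨s, hs⟩ := h
        refine Or.inr (Set.mem_iUnion.2 ⟨s, hs, fun hx' => ?_⟩)
        obtain ⟨t, ht⟩ := Set.mem_iUnion.1 hx'
        refine hxn ⟨e ⟨s, t⟩, ?_⟩
        show x ∈ C' (e.symm (e ⟨s, t⟩)).1 (e.symm (e ⟨s, t⟩)).2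
        rw [Equiv.symm_apply_apply]
        exact ht
      · exact Or.inl ⟨hxE, fun hx' => by
          obtain ⟨s, hs⟩ := Set.mem_iUnion.1 hx'
          exact h ⟨s, hs⟩⟩
    exact measure_mono_null hcov (measure_union_null hnull (measure_iUnion_null fun s => hnull' s))

/-- The one-piece localised certificate of a WILD cell (companion of `localWildCert_of_tameCell`). -/
theorem localWildCert_of_wildCellCert {q : ℕ} {E : Set (Fin 1 → ℝ)} {c κ : Fin q → (Fin 1 → ℝ) → ℝ}
    {M : Fin q → ℕ} {σ : Fin q → Fin 3} (hEo : IsOpen E) (hE : IsSemialgebraic ℚ E)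
    (hw : WildCellCert E c κ M σ) : LocalWildCert E c κ M σ := by
  refine ⟨1, fun _ => E, fun _ => hEo, fun _ => hE, fun _ => Subset.rfl, ?_, ?_, fun _ => Or.inr hw⟩
  · intro i j hij
    exact absurd (Subsingleton.elim i j) hij
  · have h : E \ ⋃ _s : Fin 1, E = ∅ := by
      rw [Set.iUnion_const, sdiff_self]
    rw [h, measure_empty]

/-- **`LocalWildCert` is local**: if finitely many pairwise disjoint pieces `C s ⊆ E` cover `E` up to a null set and
each piece carries a localised wild certificate, then so does `E`. -/
theorem localWildCert_of_pieces {q : ℕ} {E : Set (Fin 1 → ℝ)} {c κ : Fin q → (Fin 1 → ℝ) → ℝ}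
    {M : Fin q → ℕ} {σ : Fin q → Fin 3} {ι : Type*} [Fintype ι] {C : ι → Set (Fin 1 → ℝ)} (hCE : ∀ s, C s ⊆ E)
    (hdisj : Pairwise (Function.onFun Disjoint C)) (hnull : volume (E \ ⋃ s, C s) = 0)
    (hloc : ∀ s, LocalWildCert (C s) c κ M σ) : LocalWildCert E c κ M σ := by
  obtain ⟨N'', C'', hsubE, hdisj'', hnull'', hR⟩ := exists_flatten_partition volume
    (R := fun X => IsOpen X ∧ IsSemialgebraic ℚ X ∧ (TameCell X c κ M σ ∨ WildCellCert X c κ M σ)) hCE hdisj hnull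
    (fun s => by
      obtain ⟨N', C', ho, hsa, hsub, hd, hn, hP⟩ := hloc s
      exact ⟨N', C', hsub, hd, hn, fun t => ⟨ho t, hsa t, hP t⟩⟩)
  exact ⟨N'', C'', fun u => (hR u).1, fun u => (hR u).2.1, hsubE, hdisj'', hnull'', fun u => (hR u).2.2⟩

/-! ### §3am SIGN-CONDITION LOCALISATION (g11; the o-minimal triviality behind F1 of the g12 plan)
Cutting a cell `E` by the strict signs of finitely many continuous `ℚ`-semialgebraic functions `h k` gives pairwise
disjoint OPEN `ℚ`-semialgebraic pieces `signPiece E h ε` (`ε` = sign pattern) covering `E` up to the zero sets of the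
`h k`; when those are null (e.g. finite: a one-variable semialgebraic function not vanishing on a subinterval), the pieces
are an admissible localisation for `LocalWildCert` (`localWildCert_of_signPieces`).  No point of the line is ever named,
so rationality of cut points never arises (addendum 2 §E). -/

/-- The SIGN-PATTERN PIECE of `E` cut by finitely many functions `h k` with prescribed strict signs `ε`. -/
def signPiece {K : ℕ} (E : Set (Fin 1 → ℝ)) (h : Fin K → (Fin 1 → ℝ) → ℝ) (ε : Fin K → Bool) :
    Set (Fin 1 → ℝ) :=
  {x | x ∈ E ∧ ∀ k, if ε k then 0 < h k x else h k x < 0}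

/-- Auxiliary step `signPiece_subset` (§3am): sign Piece subset. [bookkeeping] -/
theorem signPiece_subset {K : ℕ} {E : Set (Fin 1 → ℝ)} {h : Fin K → (Fin 1 → ℝ) → ℝ} (ε : Fin K → Bool) :
    signPiece E h ε ⊆ E := fun _ hx => hx.1

/-- Auxiliary step `signPiece_eq_inter` (§3am): sign Piece eq inter. [bookkeeping] -/
theorem signPiece_eq_inter {K : ℕ} (E : Set (Fin 1 → ℝ)) (h : Fin K → (Fin 1 → ℝ) → ℝ) (ε : Fin K → Bool) :
    signPiece E h ε = E ∩ ⋂ k, (if ε k then {x | x ∈ E ∧ 0 < h k x} else {x | x ∈ E ∧ h k x < 0}) := by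
  ext x
  simp only [signPiece, mem_setOf_eq, mem_inter_iff, mem_iInter]
  constructor
  · rintro ⟨hxE, hs⟩
    refine ⟨hxE, fun k => ?_⟩
    have hk := hs k
    by_cases hε : ε k = true
    · rw [if_pos hε] at hk ⊢; exact ⟨hxE, hk⟩
    · rw [if_neg hε] at hk ⊢; exact ⟨hxE, hk⟩
  · rintro ⟨hxE, hs⟩
    refine ⟨hxE, fun k => ?_⟩
    have hk := hs k
    by_cases hε : ε k = true
    · rw [if_pos hε] at hk ⊢; exact hk.2
    · rw [if_neg hε] at hk ⊢; exact hk.2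

/-- Auxiliary step `isOpen_signPiece` (§3am): is Open sign Piece. [bookkeeping] -/
theorem isOpen_signPiece {K : ℕ} {E : Set (Fin 1 → ℝ)} {h : Fin K → (Fin 1 → ℝ) → ℝ} (hEo : IsOpen E)
    (hcont : ∀ k, ContinuousOn (h k) E) (ε : Fin K → Bool) : IsOpen (signPiece E h ε) := by
  rw [signPiece_eq_inter]
  refine hEo.inter (isOpen_iInter_of_finite fun k => ?_)
  by_cases hε : ε k = true
  · rw [if_pos hε]
    exact (hcont k).isOpen_inter_preimage hEo isOpen_Ioi
  · rw [if_neg hε]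
    exact (hcont k).isOpen_inter_preimage hEo isOpen_Iio

/-- Auxiliary step `isSemialgebraic_signPiece` (§3am): is Semialgebraic sign Piece. [bookkeeping] -/
theorem isSemialgebraic_signPiece {K : ℕ} {E : Set (Fin 1 → ℝ)} {h : Fin K → (Fin 1 → ℝ) → ℝ}
    (hE : IsSemialgebraic ℚ E) (hsa : ∀ k, IsSemialgebraicFunOn ℚ E (h k)) (ε : Fin K → Bool) :
    IsSemialgebraic ℚ (signPiece E h ε) := by
  rw [signPiece_eq_inter]
  have h0 : IsSemialgebraicFunOn ℚ E (fun _ => (0:ℝ)) :=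
    (isSemialgebraicFunOn_ratCast hE 0).congr fun _ _ => by simp
  have hk : ∀ k, IsSemialgebraic ℚ (if ε k then {x | x ∈ E ∧ 0 < h k x} else {x | x ∈ E ∧ h k x < 0}) := by
    intro k
    by_cases hε : ε k = true
    · rw [if_pos hε]
      convert (IsSemialgebraicFunOn.sub_holds h0 (hsa k)).isSemialgebraic_sep_neg using 1
      ext x; simp only [mem_setOf_eq, Pi.sub_apply, sub_neg]
    · rw [if_neg hε]
      exact (hsa k).isSemialgebraic_sep_neg
  have hI : IsSemialgebraic ℚ (⋂ k, (if ε k then {x | x ∈ E ∧ 0 < h k x} else {x | x ∈ E ∧ h k x < 0})) := by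
    simpa using IsSemialgebraic.biInter Finset.univ
      (fun k => if ε k then {x | x ∈ E ∧ 0 < h k x} else {x | x ∈ E ∧ h k x < 0}) fun k _ => hk k
  exact hE.inter hI

/-- Auxiliary step `pairwise_disjoint_signPiece` (§3am): pairwise disjoint sign Piece. [bookkeeping] -/
theorem pairwise_disjoint_signPiece {K : ℕ} (E : Set (Fin 1 → ℝ)) (h : Fin K → (Fin 1 → ℝ) → ℝ) :
    Pairwise (Function.onFun Disjoint (signPiece E h)) := by
  intro ε ε' hne
  obtain ⟨k, hk⟩ := Function.ne_iff.mp hne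
  rw [Function.onFun, Set.disjoint_left]
  intro x hx hx'
  have h1 := hx.2 k
  have h2 := hx'.2 k
  cases hε : ε k <;> cases hε' : ε' k <;> simp only [hε, hε', if_true, if_false, Bool.false_eq_true] at h1 h2 hk
  · exact absurd rfl hk
  · linarith
  · linarith
  · exact absurd rfl hk

end CylLog
end RegularisedLogLayer
end Summit.KontsevichZagierPeriods.RootDecompRelativeModAbsolute.Rung30571
end
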